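import Mathlib.Analysis.Calculus.FDeriv.Mul
import Literature.Analysis.Calculus.RadialCalculus
import HarnessLib

/-!
# Differentiating tangential forms: the Leibniz rule through the tangential projection

Analysis support file (everything proved; no definitions, no named facts) for the cylindrical
coordinates of A. Waldron, *Long-time existence for Yang–Mills flow*, Invent. math. 217 (2019),
§4, done extrinsically. A tangential (vector-valued) 1-form, resp. 2-form, field on the spheres
`S_r ⊂ E` is an ambient field of (bi)linear maps precomposed with the tangential projection
`P_y` (`RadialCalculus`): `y ↦ α_y ∘ P_y`, `y ↦ B_y(P_y ·, P_y ·)` (e.g. Waldron's `Ω = F(P·,P·)`,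
`ω = D^*F ∘ P`). Their derivatives along `u` at `x ≠ 0`, with the arguments frozen at `x`,
pick up the derivative of `P` — the source of the extrinsic curvature terms of `S_r`
(`∂_uP = −(∂_uν) ⊗ ν − ν ⊗ ∂_uν`):

* `fderiv_clm_tangentialProj_apply` — `D(y ↦ α_y(P_y a))(x)u = (Dα(x)u)(P_x a) + α_x((∂_uP)a)`;
* `fderiv_bilinear_tangentialProj_apply` —
  `D(y ↦ B_y(P_y a, P_y b))(x)u = (DB(x)u)(P a, P b) + B((∂_uP)a, P b) + B(P a, (∂_uP)b)`;
* `tangentialProjDeriv_of_inner_eq_zero` — for tangential `a` (`⟨x, a⟩ = 0`):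
  `(∂_uP)a = −(⟨P_x u, a⟩/‖x‖²) x` (purely radial), whence the tangential ("Levi-Civita") parts
  of the derivatives above are just `(Dα(x)u)(a)`, `(DB(x)u)(a, b)`:
  `fderiv_clm_tangentialProj_apply_of_tangential`, `fderiv_bilinear_tangentialProj_apply_of_tangential`.

References: A. Waldron, Invent. math. 217 (2019), §4.1–4.2 [Waldron2019]; (submanifold
geometry of round spheres) [folklore].
-/

noncomputable section

open scoped RealInnerProductSpace Topology

namespace Literature.Analysis.Calculus

variable {E : Type*} [NormedAddCommGroup E] [InnerProductSpace ℝ E]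
variable {F : Type*} [NormedAddCommGroup F] [NormedSpace ℝ F]

/-- The derivative of `y ↦ P_y a` at `x ≠ 0` in the direction `u`, as a vector:
`(∂_uP)a = −(⟨x, a⟩ P_x u + ⟨P_x u, a⟩ x)/‖x‖²`. [folklore] -/
theorem fderiv_tangentialProj_apply {x : E} (hx : x ≠ 0) (a u : E) :
    fderiv ℝ (fun y => tangentialProj y a) x u =
      -(‖x‖ ^ 2)⁻¹ • (⟪x, a⟫ • tangentialProj x u + ⟪tangentialProj x u, a⟫ • x) := by
  rw [(hasFDerivAt_tangentialProj_apply hx a).fderiv]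
  simp [ContinuousLinearMap.smulRight_apply, innerSL_apply_apply, inner_tangentialProj_comm x a u,
    real_inner_comm a]

/-- For a tangential vector `a` (`⟨x, a⟩ = 0`) the derivative of the projection is purely radial:
`(∂_uP)a = −(⟨P_x u, a⟩/‖x‖²) x`. [folklore] -/
theorem tangentialProjDeriv_of_inner_eq_zero {x : E} (hx : x ≠ 0) {a : E} (ha : ⟪x, a⟫ = 0)
    (u : E) :
    fderiv ℝ (fun y => tangentialProj y a) x u = -((‖x‖ ^ 2)⁻¹ * ⟪tangentialProj x u, a⟫) • x := by
  rw [fderiv_tangentialProj_apply hx, ha, zero_smul, zero_add, smul_smul, neg_mul]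

/-- **Leibniz rule for a tangential 1-form**: for `α : E → (E →L F)` differentiable at `x ≠ 0`
and a frozen argument `a`,
`D(y ↦ α_y(P_y a))(x)u = (Dα(x)u)(P_x a) + α_x((∂_uP)a)`. [folklore] -/
theorem fderiv_clm_tangentialProj_apply {α : E → E →L[ℝ] F} {x : E} (hα : DifferentiableAt ℝ α x)
    (hx : x ≠ 0) (a u : E) :
    fderiv ℝ (fun y => α y (tangentialProj y a)) x u =
      fderiv ℝ α x u (tangentialProj x a) +
        α x (-(‖x‖ ^ 2)⁻¹ • (⟪x, a⟫ • tangentialProj x u + ⟪tangentialProj x u, a⟫ • x)) := by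
  have hP := (hasFDerivAt_tangentialProj_apply hx a).differentiableAt
  rw [fderiv_clm_apply hα hP]
  simp only [FunLike.coe_add, Pi.add_apply, ContinuousLinearMap.comp_apply,
    ContinuousLinearMap.flip_apply]
  rw [fderiv_tangentialProj_apply hx a u, add_comm]

/-- The same for a tangential frozen argument: `D(y ↦ α_y(P_y a))(x)u = (Dα(x)u)(a) −
(⟨P_x u, a⟩/‖x‖²) α_x(x)`; in particular, if also `α_x(x) = 0` (a form vanishing on the radial
direction), the derivative is just `(Dα(x)u)(a)`. [folklore] -/
theorem fderiv_clm_tangentialProj_apply_of_tangential {α : E → E →L[ℝ] F} {x : E}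
    (hα : DifferentiableAt ℝ α x) (hx : x ≠ 0) {a : E} (ha : ⟪x, a⟫ = 0) (u : E) :
    fderiv ℝ (fun y => α y (tangentialProj y a)) x u =
      fderiv ℝ α x u a - ((‖x‖ ^ 2)⁻¹ * ⟪tangentialProj x u, a⟫) • α x x := by
  rw [fderiv_clm_tangentialProj_apply hα hx, tangentialProj_eq_self ha, ha, zero_smul, zero_add,
    smul_smul, map_smul, neg_mul, neg_smul, sub_eq_add_neg]

/-- **Leibniz rule for a tangential 2-form**: for `B : E → (E →L E →L F)` differentiable at
`x ≠ 0` and frozen arguments `a, b`,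
`D(y ↦ B_y(P_y a, P_y b))(x)u = (DB(x)u)(P a, P b) + B((∂_uP)a, P b) + B(P a, (∂_uP)b)`.
[folklore] -/
theorem fderiv_bilinear_tangentialProj_apply {B : E → E →L[ℝ] E →L[ℝ] F} {x : E}
    (hB : DifferentiableAt ℝ B x) (hx : x ≠ 0) (a b u : E) :
    fderiv ℝ (fun y => B y (tangentialProj y a) (tangentialProj y b)) x u =
      fderiv ℝ B x u (tangentialProj x a) (tangentialProj x b) +
        B x (-(‖x‖ ^ 2)⁻¹ • (⟪x, a⟫ • tangentialProj x u + ⟪tangentialProj x u, a⟫ • x))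
          (tangentialProj x b) +
        B x (tangentialProj x a)
          (-(‖x‖ ^ 2)⁻¹ • (⟪x, b⟫ • tangentialProj x u + ⟪tangentialProj x u, b⟫ • x)) := by
  have hPa := (hasFDerivAt_tangentialProj_apply hx a).differentiableAt
  have hPb := (hasFDerivAt_tangentialProj_apply hx b).differentiableAt
  -- first the inner evaluation `y ↦ B_y(P_y a)`, a `CLM`-valued function
  have h1 : DifferentiableAt ℝ (fun y => B y (tangentialProj y a)) x := hB.clm_apply hPa
  have h1' : fderiv ℝ (fun y => B y (tangentialProj y a)) x u =
      fderiv ℝ B x u (tangentialProj x a) +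
        B x (-(‖x‖ ^ 2)⁻¹ • (⟪x, a⟫ • tangentialProj x u + ⟪tangentialProj x u, a⟫ • x)) := by
    rw [fderiv_clm_apply hB hPa]
    simp only [FunLike.coe_add, Pi.add_apply, ContinuousLinearMap.comp_apply,
      ContinuousLinearMap.flip_apply]
    rw [fderiv_tangentialProj_apply hx a u, add_comm]
  rw [fderiv_clm_apply h1 hPb]
  simp only [FunLike.coe_add, Pi.add_apply, ContinuousLinearMap.comp_apply,
    ContinuousLinearMap.flip_apply]
  rw [h1', fderiv_tangentialProj_apply hx b u, FunLike.coe_add, Pi.add_apply]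
  abel

/-- The same for tangential frozen arguments `a, b ⊥ x`:
`D(y ↦ B_y(P_y a, P_y b))(x)u = (DB(x)u)(a, b) − (⟨P u, a⟩/‖x‖²) B(x, b) − (⟨P u, b⟩/‖x‖²) B(a, x)`
— the extrinsic form of the Gauss–Codazzi coupling between a tangential 2-form `Ω = F(P·,P·)`
and the radial contraction `Φ = F(x, P·)` in Waldron's split `F = ds ∧ Φ + Ω`. [folklore] -/
theorem fderiv_bilinear_tangentialProj_apply_of_tangential {B : E → E →L[ℝ] E →L[ℝ] F} {x : E}
    (hB : DifferentiableAt ℝ B x) (hx : x ≠ 0) {a b : E} (ha : ⟪x, a⟫ = 0) (hb : ⟪x, b⟫ = 0)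
    (u : E) :
    fderiv ℝ (fun y => B y (tangentialProj y a) (tangentialProj y b)) x u =
      fderiv ℝ B x u a b - ((‖x‖ ^ 2)⁻¹ * ⟪tangentialProj x u, a⟫) • B x x b -
        ((‖x‖ ^ 2)⁻¹ * ⟪tangentialProj x u, b⟫) • B x a x := by
  rw [fderiv_bilinear_tangentialProj_apply hB hx, tangentialProj_eq_self ha,
    tangentialProj_eq_self hb, ha, hb]
  simp only [zero_smul, zero_add, smul_smul, map_smul, neg_mul, neg_smul,
    FunLike.coe_smul, Pi.smul_apply, map_neg, FunLike.coe_neg,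
    Pi.neg_apply]
  abel

end Literature.Analysis.Calculus
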